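import Literature.MathematicalPhysics.PowerSystems.LosslessMultimachineTypeCount
import Literature.MathematicalPhysics.PowerSystems.RingTwistedStateInstability
import HarnessLib

/-!
# The twisted states of the homogeneous ring: TYPE `0` with an exponential rate when
# `cos(2πq/N) > 0`, MAXIMAL type `N − 1` when `cos(2πq/N) < 0` — the spectral form of
# «q-twisted states are stable iff |q| < N/4»

Topic `Literature/MathematicalPhysics/PowerSystems`, namespace
`Literature.MathematicalPhysics.PowerSystems.ClassicalModel` (lit-1's ring records
`RingMultistability.lean`: `ringSystem n K M D : LosslessSystem (n+1) 0`, `twistedState n q`,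
`twistedState_isSyncState`, `twistedState_normalOperation`, `ringSystem_couplingConnected`,
`ringSystem_C_symm / _nonneg`, `ringSystem_flow_twistedState`; `RingTwistedStateInstability.lean`:
`hessForm_twistedState_neg`; and this seat's `LosslessMultimachineTypeCount.lean`:
`phaseJac`, `expStable_modRotation_of_normalOperation`, `typeMax_modRotation_of_hessForm_neg`,
`countP_roots_charpoly_phaseJac_modRotation`, `refMinor_pos_of_hessForm_pos` — all used UNCHANGED).
The ring files prove «stable» (energy route: Lyapunov stability + convergence, `twistedState_stable`)
and «unstable» (`twistedState_unstable`) for the MOTIONS; this file adds the SPECTRAL column: the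
exponential RATE of the stable twisted states and the TYPE (number of right-half-plane eigenvalues of
the phase-space Jacobian, Chiang's «type-k») of every twisted state with `cos(2πq/N) ≠ 0`. Everything
is PROVED; no definition, no named fact.

SOURCES (read on the page by the ring files' author and this seat). D. A. Wiley, S. H. Strogatz,
M. Girvan, Chaos 16 (2006) 015103 [WileyStrogatzGirvan2006] (q-twisted states, stable iff |q| < N/4);
A. Mihara et al., Chaos 32 (2022) [MiharaEtAl2022] §I eq. (4) (the transversal eigenvalues
`γ_ℓ(q) = −4G cos(2πq/N) sin²(πℓ/N)` of the ring: ALL of one sign); D. Manik, M. Timme, D. Witthaut,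
Chaos 27 (2017) 083123 [ManikTimmeWitthaut2017] §3 Lemma 1 / Cor. 1, §5.4; H.-D. Chiang, IMA 64 (1995)
[Chiang1995] §2 p. 46 (type-k), §6.3 Thm 6.1; H. K. Khalil, *Nonlinear Systems*, Thm 4.7 [Khalil2002].

## What is proved (`ringSystem n K M D`, `N = n + 1 ≥ 3` machines, `K > 0`, `Mᵢ, Dᵢ > 0`)

* `twistedState_isEquilibrium` (the twisted states are rest points: `P = 0 = flow`).
* **`twistedState_expStable_modRotation`** (`4|q| < N`: `∃ ρ, k, λ > 0`, every solution of the ring's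
  swing equations with `‖x(0) − (θ_q, 0)‖ < ρ` obeys `‖x(t) − (θ_q + c𝟙, 0)‖ ≤ k‖x(0) − (θ_q + c𝟙, 0)‖e^{−λt}`,
  `c` the momentum offset — the RATE behind `twistedState_stable`).
* **`twistedState_typeZero`** (`4|q| < N`: `#{Re > 0} = 0`, `#{Re < 0} = 2N − 1`, `#{Re = 0} = 1`:
  a hyperbolic sink modulo the rotation) and **`twistedState_typeMax`** (`cos(2πq/N) < 0`:
  `#{Re > 0} = N − 1`, `#{Re < 0} = N`, `#{Re = 0} = 1`: EVERY transversal direction unstable — all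
  `γ_ℓ(q) > 0`), for the characteristic roots of the phase-space Jacobian `phaseJac (θ_q)` counted
  with multiplicity.

THREE COLUMNS. Statements about the ring MODEL `R_N` (homogeneous unloaded lossless ring, second-order
swing dynamics) at its twisted states; «type», «rate» are properties of the MODEL's rest points.
Nothing about any grid. The borderline `cos(2πq/N) = 0` (`4|q| = N`, degenerate) is not covered.

## References
* [WileyStrogatzGirvan2006] D. A. Wiley, S. H. Strogatz, M. Girvan, The size of the sync basin, Chaos 16
  (2006) 015103. [MiharaEtAl2022] A. Mihara, M. Kuwana, et al., Chaos 32 (2022), §I eqs. (3)–(4).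
* [ManikTimmeWitthaut2017] D. Manik, M. Timme, D. Witthaut, Chaos 27 (2017) 083123, §3, §5.4.
* [Chiang1995] H.-D. Chiang, in: Systems and Control Theory for Power Systems, IMA 64, 1995, §2, §6.3.
* [Khalil2002] H. K. Khalil, Nonlinear Systems, 3rd ed., 2002, Theorem 4.7.

AI-produced formalisation (LADDER-GRIDFUSION seat gridfusion-lit-2 g10, 2026-08-28).
-/

set_option autoImplicit false

noncomputable section

open Set Finset Matrix
open scoped Matrix BigOperators
open Literature.LinearAlgebra.Matrix

namespace Literature.MathematicalPhysics.PowerSystems.ClassicalModel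

section Ring

variable {n : ℕ} (K : ℝ) (M D : Fin (n + 1) → ℝ) (q : ℤ)

/-- The twisted states are REST POINTS of the unloaded ring (`Pᵢ = 0 = flowᵢ(θ_q)`).
[cite: ManikTimmeWitthaut2017, §5.4; MiharaEtAl2022, §I eq. (3)] -/
theorem twistedState_isEquilibrium (hn : 2 ≤ n) :
    (ringSystem n K M D).IsEquilibrium (twistedState n q) := fun k => by
  rw [ringSystem_flow_twistedState K M D q hn k]; rfl

/-- The Hesse form of the ring has no bus part: `vᵀ𝕄(θ)v = ½ΣΣ Cᵢⱼcos(θᵢ − θⱼ)(vᵢ − vⱼ)²`.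
[cite: ManikTimmeWitthaut2017, §3 eq. (M)] -/
private theorem ring_dotProduct_hessMatrix_mulVec (θ v : Fin (n + 1) → ℝ) :
    v ⬝ᵥ ((ringSystem n K M D).hessMatrix θ *ᵥ v)
      = 1 / 2 * ∑ i, ∑ j, (ringSystem n K M D).C i j * Real.cos (θ i - θ j) * (v i - v j) ^ 2 := by
  rw [(ringSystem n K M D).dotProduct_hessMatrix_mulVec (ringSystem_C_symm K M D) θ v]
  simp

/-- **STABLE TWISTED STATES ATTRACT AT AN EXPONENTIAL RATE** (`K > 0`, `Mᵢ, Dᵢ > 0`, `4|q| < N`,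
`N = n + 1 ≥ 3`): `∃ ρ, k, λ > 0` such that every solution of the ring's swing equations on `[0, T]`
with `‖x(0) − (θ_q, 0)‖ < ρ` satisfies `‖x(t) − (θ_q + c𝟙, 0)‖ ≤ k‖x(0) − (θ_q + c𝟙, 0)‖e^{−λt}`,
`c = (Σ Dᵢ(θᵢ(0) − θ_{q,i}) + Σ Mᵢωᵢ(0))/Σ Dᵢ` — the exponential RATE of «twisted states are stable
for |q| < N/4» (the energy route `twistedState_stable` gives stability + convergence).
[cite: WileyStrogatzGirvan2006, (q-twisted states stable for |q| < N/4); MiharaEtAl2022, §I eq. (4); ManikTimmeWitthaut2017, §3 Cor. 1] [cite: Khalil2002, Theorem 4.7] -/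
theorem twistedState_expStable_modRotation (hn : 2 ≤ n) (hK : 0 < K) (hM : ∀ i, 0 < M i)
    (hD : ∀ i, 0 < D i) (hq : 4 * |q| < (n : ℤ) + 1) :
    ∃ ρ > 0, ∃ k > 0, ∃ lam > 0, ∀ (X : ℝ → (Fin (n + 1) → ℝ) × (Fin (n + 1) → ℝ)) (T : ℝ),
      (∀ t ∈ Icc 0 T, HasDerivWithinAt X ((ringSystem n K M D).field (X t)) (Icc 0 T) t) →
      ‖X 0 - (twistedState n q, 0)‖ < ρ →
      ∀ t ∈ Icc 0 T,
        ‖X t - ((fun i => twistedState n q i + (ringSystem n K M D).momWeights ⬝ᵥ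
            (LosslessSystem.flat (X 0) - LosslessSystem.flat (twistedState n q, 0)) / ∑ i, D i), 0)‖
          ≤ k * ‖X 0 - ((fun i => twistedState n q i + (ringSystem n K M D).momWeights ⬝ᵥ
              (LosslessSystem.flat (X 0) - LosslessSystem.flat (twistedState n q, 0)) / ∑ i, D i), 0)‖
            * Real.exp (-lam * t) :=
  (ringSystem n K M D).expStable_modRotation_of_normalOperation (ringSystem_C_symm K M D)
    (ringSystem_C_nonneg K M D hK.le) (ringSystem_couplingConnected K M D hK) hM hD
    (twistedState_isEquilibrium K M D q hn) (twistedState_normalOperation K M D q hq) 0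

/-- **STABLE TWISTED STATES ARE HYPERBOLIC SINKS MODULO THE ROTATION** (`4|q| < N`): the phase-space
Jacobian at `θ_q` has NO characteristic root with positive real part, `2N − 1` with negative real
part and the simple rotation root (type `0`; all `γ_ℓ(q) < 0`).
[cite: MiharaEtAl2022, §I eq. (4); Chiang1995, §2 (p. 46), §6.3 Theorem 6.1] -/
theorem twistedState_typeZero (hK : 0 < K) (hM : ∀ i, 0 < M i) (hD : ∀ i, 0 < D i)
    (hq : 4 * |q| < (n : ℤ) + 1) :
    (((ringSystem n K M D).phaseJac (twistedState n q)).map (algebraMap ℝ ℂ)).charpoly.roots.countP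
        (fun μ => 0 < μ.re) = 0 ∧
      (((ringSystem n K M D).phaseJac (twistedState n q)).map (algebraMap ℝ ℂ)).charpoly.roots.countP
        (fun μ => μ.re < 0) = 2 * (n + 1) - 1 ∧
      (((ringSystem n K M D).phaseJac (twistedState n q)).map (algebraMap ℝ ℂ)).charpoly.roots.countP
        (fun μ => μ.re = 0) = 1 := by
  set S := ringSystem n K M D with hS
  have hC := ringSystem_C_symm K M D
  have hform : ∀ v : Fin (n + 1) → ℝ, (∃ i j, v i ≠ v j) →
      0 < v ⬝ᵥ (S.hessMatrix (twistedState n q) *ᵥ v) := by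
    intro v hv
    rw [S.dotProduct_hessMatrix_mulVec hC]
    exact S.hessForm_pos_of_cohesive_of_connected (ringSystem_C_nonneg K M D hK.le)
      (ringSystem_couplingConnected K M D hK) (twistedState_normalOperation K M D q hq) v hv
  have hposu := S.refMinor_pos_of_hessForm_pos (twistedState n q) 0 hform
  have hHm : (refMinor (S.hessMatrix (twistedState n q)) 0).IsHermitian :=
    refMinor_isHermitian (S.hessMatrix_isHermitian hC _) 0
  have hPD : (refMinor (S.hessMatrix (twistedState n q)) 0).PosDef :=
    Matrix.PosDef.of_dotProduct_mulVec_pos hHm fun x hx => by rw [star_trivial]; exact hposu x hx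
  have hreg : ∀ u : {k : Fin (n + 1) // k ≠ 0} → ℝ,
      refMinor (S.hessMatrix (twistedState n q)) 0 *ᵥ u = 0 → u = 0 := by
    intro u hu
    by_contra hne
    have h := hposu u hne
    rw [hu, dotProduct_zero] at h
    exact lt_irrefl _ h
  obtain ⟨h1, h2, h3⟩ := S.countP_roots_charpoly_phaseJac_modRotation hM hD hC (twistedState n q) 0 hHm hreg
  have hev : ∀ k, 0 < hHm.eigenvalues k := hPD.eigenvalues_pos
  have hnegc : #{k | hHm.eigenvalues k < 0} = 0 := by
    rw [Finset.card_eq_zero, Finset.filter_eq_empty_iff]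
    exact fun k _ => not_lt.2 (hev k).le
  have hposc : #{k | 0 < hHm.eigenvalues k} = n := by
    rw [Finset.filter_true_of_mem fun k _ => hev k, Finset.card_univ, Fintype.card_subtype_compl,
      Fintype.card_fin, Fintype.card_unique, Nat.add_sub_cancel]
  refine ⟨h1.trans hnegc, ?_, h3⟩
  rw [h2, hposc]; omega

/-- **UNSTABLE TWISTED STATES HAVE THE MAXIMAL TYPE `N − 1`** (`K > 0`, `Mᵢ, Dᵢ > 0`,
`cos(2πq/N) < 0`, i.e. `N/4 < |q| mod N < 3N/4`): the phase-space Jacobian at `θ_q` has exactly `N − 1`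
characteristic roots with positive real part, `N` with negative real part and the simple rotation root —
EVERY transversal direction is unstable (all `γ_ℓ(q) > 0`), the extreme opposite of normal operation.
[cite: MiharaEtAl2022, §I eq. (4) (γ_ℓ(q) = −4G cos(2πq/N) sin²(πℓ/N)); ManikTimmeWitthaut2017, §3 Lemma 1; Chiang1995, §2 (p. 46: type-k), §6.3 Theorem 6.1] -/
theorem twistedState_typeMax (hK : 0 < K) (hM : ∀ i, 0 < M i) (hD : ∀ i, 0 < D i)
    (hcos : Real.cos (2 * Real.pi * q / (n + 1)) < 0) :
    (((ringSystem n K M D).phaseJac (twistedState n q)).map (algebraMap ℝ ℂ)).charpoly.roots.countP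
        (fun μ => 0 < μ.re) = n ∧
      (((ringSystem n K M D).phaseJac (twistedState n q)).map (algebraMap ℝ ℂ)).charpoly.roots.countP
        (fun μ => μ.re < 0) = n + 1 ∧
      (((ringSystem n K M D).phaseJac (twistedState n q)).map (algebraMap ℝ ℂ)).charpoly.roots.countP
        (fun μ => μ.re = 0) = 1 := by
  have hC := ringSystem_C_symm K M D
  have hform : ∀ v : Fin (n + 1) → ℝ, (∃ i j, v i ≠ v j) →
      v ⬝ᵥ ((ringSystem n K M D).hessMatrix (twistedState n q) *ᵥ v) < 0 := by
    intro v hv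
    rw [ring_dotProduct_hessMatrix_mulVec]
    exact hessForm_twistedState_neg K M D q hK hcos v hv
  have h := (ringSystem n K M D).typeMax_modRotation_of_hessForm_neg hM hD hC (twistedState n q) 0 hform
  simpa using h

end Ring

end Literature.MathematicalPhysics.PowerSystems.ClassicalModel

end
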